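import Summits.ResolutionOfSingularities.ResolutionOfSingularities.Theorems.CrossCutCells2
import Summits.ResolutionOfSingularities.ResolutionOfSingularities.Theorems.MaxContactCutSpreadCut
import HarnessLib

/-!
# MaxContactCutCrossCut — the decomp-res node «CrossCut» BY NAME on the host route `MaxContactCut` (lens-2 g20, pin 9ac8d1ca)

Content VERBATIM from the decomp-res lens-2 g20 node `HOME/decomp-res-lens-2/g20/CrossCut.lean` (pin 9ac8d1ca, 4 409
l; HOME = run/shared/lean/pub/decomp-res);
CRITIC-LEDGER row 160 (+1); landing orders INBOX :600 (and lens INBOX :582): l. 112–3564 are `SpreadCut` b2959d31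
VERBATIM (landed as `SpreadCutLaw…` · `SpreadCutCells` ·
`MaxContactCutSpreadCut`) and are DELETED here with the landed modules imported instead (namespaces
`…Theorems.PinchCut` / `JetCut` / `PurityCut` / `SplitCut` / `CylinderCut` /
`SpreadCut` opened; same short names, byte-identical bodies — never two copies); NEW = §X (l. 3566–4407).  Namespace
`…Theorems.CrossCut` (the lens's `Theses.CrossCut` is
gate-reserved), sub-namespaces `Cross` / `Leaf` as in the lens (inside the re-entered `namespace Leaf` of §X.3 the
landed `…Theorems.PurityCut.Leaf` is opened so the g16
schema's short names resolve exactly as in the lens); file split only (tree files ≤ 400 lines): sections, variables,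
the `open MvPolynomial` lines and every declaration exactly as in
the lens; the node's global dupNamespace-linter line dropped.  Node files, in import order: `CrossCutLaw` (§X.0 ring
level; continued `…2`) · `CrossCutCells` (§X.2–§X.7
cone-free: the aside / port home; continued `…2`) · the wiring `MaxContactCutCrossCut` (§X BY NAME on the host
route, in the Theses cone).  All `--supports
stmt-ResolutionOfSingularities-29273` (`MaxContactCut.RungOne`); nothing closes 29273 — decided halves carry their
engines / ports as hypotheses (`CrossExit` is a paper engine);
exactly ONE located-residual aside on the lens-2 column (`Cross.CrossSpecialRung`) SUPERSEDES g19's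
`Spread.SpreadSpecialRung`, re-located EXACTLY modulo the cross decided half,
and `ComponentPackagePort` is the column's ONE port item.

THE WIRING of the node VERBATIM, BY NAME on the host route `MaxContactCut` (in the Theses cone), in lens order:
`Cross.rungOne_iff : MaxContactCut.RungOne ⟺ CrossGenericRung ∧ CrossSpecialRung`, **`Cross.closes`**,
`crossGenericRung_of_ports`, `closes_of_engines`, and the §X.7 EXACT re-locations
(**`spreadSpecialRung_iff_crossSpecialRung`**: g19's residual ⟺ the cross residual modulo the decided half; then cyl
/ split / grand / vast / pinch and the tree aside 33866 `MaxContactCut.LeafSpecialRung`) — 0 sorry.  Imports the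
aside home `CrossCutCells2` and `MaxContactCutSpreadCut`.  Supports 29273.

This file carries: `Cross.rungOne_iff`, `Cross.crossGenericRung_of_rungOne`, `Cross.crossSpecialRung_of_rungOne`,
`Cross.crossSpecialRung_iff_rungOne`, `Cross.closes`, `Cross.crossGenericRung_of_ports`, `Cross.closes_of_engines`,
`Cross.spreadGenericRung_of_componentPorts`, `Cross.spreadSpecialRung_iff_crossSpecialRung`,
`Cross.cylSpecialRung_iff_crossSpecialRung`, `Cross.splitSpecialRung_iff_crossSpecialRung`,
`Cross.grandSpecialRung_iff_crossSpecialRung`, `Cross.vastSpecialRung_iff_crossSpecialRung`,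
`Cross.leafSpecialRung_iff_crossSpecialRung`, `Cross.leafGenericRung_of_crossGenericRung`,
`Cross.pinchSpecialRung_iff_crossSpecialRung`, `Cross.closes_of_spreadSpecialRung`, `Cross.spread_closes_of_cross`.

(Sources: Hironaka1964 Ch. III; CossartJannsenSaito2020 Ch. 2, Ch. 8–9; CossartPiltant2008 Prop. 4.2;
CossartPiltant2019 Rem. 3.2; BierstoneGrigorievMilmanWlodarczyk2011 §3.1; Moh1987; Hauser2010Kangaroo; Giraud1975;
Narasimhan1983.)
-/

open CategoryTheory AlgebraicGeometry TopologicalSpace IsLocalRing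
open Literature.AlgebraicGeometry.Resolution
open Summit.ResolutionOfSingularities.ResolutionOfSingularities.Theorems
open Summit.ResolutionOfSingularities.ResolutionOfSingularities.Theorems.WeakOrderReduction
open Summit.ResolutionOfSingularities.ResolutionOfSingularities.Theorems.DeltaFaceCutClasses
open Summit.ResolutionOfSingularities.ResolutionOfSingularities.Theorems.RelativeDeltaCut
open Summit.ResolutionOfSingularities.ResolutionOfSingularities.Theorems.CurveLeafExit
open Summit.ResolutionOfSingularities.ResolutionOfSingularities.Theorems.PinchCut
open Summit.ResolutionOfSingularities.ResolutionOfSingularities.Theorems.JetCut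
open Summit.ResolutionOfSingularities.ResolutionOfSingularities.Theorems.PurityCut
open Summit.ResolutionOfSingularities.ResolutionOfSingularities.Theorems.SplitCut
open Summit.ResolutionOfSingularities.ResolutionOfSingularities.Theorems.CylinderCut
open Summit.ResolutionOfSingularities.ResolutionOfSingularities.Theorems.SpreadCut
open MvPolynomial
open Summit.ResolutionOfSingularities.ResolutionOfSingularities.Theses

namespace Summit.ResolutionOfSingularities.ResolutionOfSingularities.Theorems.CrossCut

namespace Cross

section Kernels

variable {n : ℕ}

/-- **EXACT AT THE RUNG**: `RungOne ⟺ CrossGenericRung ∧ CrossSpecialRung`. [folklore] -/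
theorem rungOne_iff : MaxContactCut.RungOne ↔ CrossGenericRung ∧ CrossSpecialRung :=
  Leaf.rungOne_iff (L := crossLeaf)

/-- NECESSITY by letter. [folklore] -/
theorem crossGenericRung_of_rungOne (h : MaxContactCut.RungOne) : CrossGenericRung := (rungOne_iff.mp h).1

/-- NECESSITY by letter. [folklore] -/
theorem crossSpecialRung_of_rungOne (h : MaxContactCut.RungOne) : CrossSpecialRung := (rungOne_iff.mp h).2

/-- HONESTY KERNEL: modulo the decided half, the located residual IS the rung (cofinal). [folklore] -/
theorem crossSpecialRung_iff_rungOne (hG : CrossGenericRung) : CrossSpecialRung ↔ MaxContactCut.RungOne :=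
  Leaf.specialRung_iff_rungOne (L := crossLeaf) hG

/-- **DECIDING IMPLICATION OF THE NODE**: `MaxContactCut.RungOne` (29273) BY NAME from the two halves. [folklore] -/
theorem closes (hG : CrossGenericRung) (hS : CrossSpecialRung) : MaxContactCut.RungOne :=
  Leaf.closes (L := crossLeaf) hG hS

/-- **`CrossGenericRung` with the cylinder engine DISCHARGED by the ports**: (JCyl), (Γ) and (X) decided on paper,
X1 via the TREE aside
30081 `MaxContactCut.MaxOrderThreefoldResolution` BY NAME. [folklore] -/
theorem crossGenericRung_of_ports (hV : VeryNearCutClasses.VeryNearExit) (hD : DeltaPackageExit)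
    (hU : UniformCurvePackageExit) (hR : RelCurvePackageExit) (hN : NormalConeJumpExit)
    (hM : MonomialPinchExit) (hC : FlatConeExit) (hGE : GrandExit) (hSE : SplitConeExit)
    (hJE : JetCylinderExit) (hX : MaxContactCut.MaxOrderThreefoldResolution) (hΓE : SpreadExit) (hXE : CrossExit)
    (hP : ∀ n : ℕ, 2 ≤ n → ComponentPackagePort n) (h1 : FaceFormCutClasses.OrderOneContact) : CrossGenericRung :=
  crossGenericRung_of_engines hV hD hU hR hN hM hC hGE hSE (cylinderExit_of_ports hJE hX) hJE hΓE hXE hP h1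

/-- `RungOne` BY NAME from the engines, the ports and the located residual. [folklore] -/
theorem closes_of_engines (hV : VeryNearCutClasses.VeryNearExit) (hD : DeltaPackageExit)
    (hU : UniformCurvePackageExit) (hR : RelCurvePackageExit) (hN : NormalConeJumpExit)
    (hM : MonomialPinchExit) (hC : FlatConeExit) (hGE : GrandExit) (hSE : SplitConeExit)
    (hJE : JetCylinderExit) (hX : MaxContactCut.MaxOrderThreefoldResolution) (hΓE : SpreadExit) (hXE : CrossExit)
    (hP : ∀ n : ℕ, 2 ≤ n → ComponentPackagePort n) (h1 : FaceFormCutClasses.OrderOneContact)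
    (hS : CrossSpecialRung) : MaxContactCut.RungOne :=
  closes (crossGenericRung_of_ports hV hD hU hR hN hM hC hGE hSE hJE hX hΓE hXE hP h1) hS

/-- g19's decided half over the COMPONENT port (consistency: the component port discharges g12's curve port by
letter). [folklore] -/
theorem spreadGenericRung_of_componentPorts (hV : VeryNearCutClasses.VeryNearExit) (hD : DeltaPackageExit)
    (hU : UniformCurvePackageExit) (hR : RelCurvePackageExit) (hN : NormalConeJumpExit)
    (hM : MonomialPinchExit) (hC : FlatConeExit) (hGE : GrandExit) (hSE : SplitConeExit)
    (hJE : JetCylinderExit) (hX : MaxContactCut.MaxOrderThreefoldResolution) (hΓE : SpreadExit)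
    (hP : ∀ n : ℕ, 2 ≤ n → ComponentPackagePort n) (h1 : FaceFormCutClasses.OrderOneContact) : Spread.SpreadGenericRung :=
  Spread.spreadGenericRung_of_ports hV hD hU hR hN hM hC hGE hSE hJE hX hΓE
    (fun n hn => curvePackagePort_of_componentPackagePort (hP n hn)) h1

/-- **EXACT RE-LOCATION OF g19's `Spread.SpreadSpecialRung`** (the located residual the instruction names): modulo
the cross decided half,
`Spread.SpreadSpecialRung ⟺ CrossSpecialRung`. [folklore] -/
theorem spreadSpecialRung_iff_crossSpecialRung (hG : CrossGenericRung) : Spread.SpreadSpecialRung ↔ CrossSpecialRung :=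
  Spread.spreadSpecialRung_iff.trans (Leaf.specialRung_iff_of_le spreadLeaf_le_crossLeaf hG)

/-- **EXACT RE-LOCATION OF g18's `Cyl.CylSpecialRung`**: modulo the cross decided half, `Cyl.CylSpecialRung ⟺
CrossSpecialRung`. [folklore] -/
theorem cylSpecialRung_iff_crossSpecialRung (hG : CrossGenericRung) : Cyl.CylSpecialRung ↔ CrossSpecialRung :=
  Cyl.cylSpecialRung_iff.trans (Leaf.specialRung_iff_of_le cylLeaf_le_crossLeaf hG)

/-- **EXACT RE-LOCATION OF g17's `Split.SplitSpecialRung`**: modulo the cross decided half, `Split.SplitSpecialRung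
⟺ CrossSpecialRung`.
[folklore] -/
theorem splitSpecialRung_iff_crossSpecialRung (hG : CrossGenericRung) : Split.SplitSpecialRung ↔ CrossSpecialRung :=
  Split.splitSpecialRung_iff.trans (Leaf.specialRung_iff_of_le splitLeaf_le_crossLeaf hG)

/-- **EXACT RE-LOCATION OF g16's `Grand.GrandSpecialRung`**: modulo the cross decided half, `Grand.GrandSpecialRung
⟺ CrossSpecialRung`.
[folklore] -/
theorem grandSpecialRung_iff_crossSpecialRung (hG : CrossGenericRung) : Grand.GrandSpecialRung ↔ CrossSpecialRung :=
  Grand.grandSpecialRung_iff.trans (Leaf.specialRung_iff_of_le grandLeaf_le_crossLeaf hG)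

/-- **EXACT RE-LOCATION OF g15's `Vast.VastSpecialRung`**: modulo the cross decided half, `Vast.VastSpecialRung ⟺
CrossSpecialRung`.
[folklore] -/
theorem vastSpecialRung_iff_crossSpecialRung (hG : CrossGenericRung) : Vast.VastSpecialRung ↔ CrossSpecialRung :=
  vastSpecialRung_iff.trans (Leaf.specialRung_iff_of_le vastLeaf_le_crossLeaf hG)

/-- **EXACT RE-LOCATION OF THE TREE ASIDE 33866** `MaxContactCut.LeafSpecialRung` BY NAME: modulo the cross decided half,
`LeafSpecialRung ⟺ CrossSpecialRung`. [folklore] -/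
theorem leafSpecialRung_iff_crossSpecialRung (hG : CrossGenericRung) : MaxContactCut.LeafSpecialRung ↔ CrossSpecialRung :=
  Leaf.leafSpecialRung_iff_specialRung (L := crossLeaf) hG

/-- The tree aside 33865 `MaxContactCut.LeafGenericRung` BY NAME from the cross decided half. [folklore] -/
theorem leafGenericRung_of_crossGenericRung (hG : CrossGenericRung) : MaxContactCut.LeafGenericRung :=
  Leaf.leafGenericRung_of_genericRung (L := crossLeaf) hG

/-- **EXACT RE-LOCATION OF g14's `PinchSpecialRung`**: modulo the cross decided half, `PinchSpecialRung ⟺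
CrossSpecialRung`. [folklore] -/
theorem pinchSpecialRung_iff_crossSpecialRung (hG : CrossGenericRung) : PinchSpecialRung ↔ CrossSpecialRung :=
  pinchSpecialRung_iff.trans (Leaf.specialRung_iff_of_le pinchLeaf_le_crossLeaf hG)

/-- `RungOne` BY NAME from the cross decided half and g19's residual (the old residual still closes). [folklore] -/
theorem closes_of_spreadSpecialRung (hG : CrossGenericRung) (hS : Spread.SpreadSpecialRung) : MaxContactCut.RungOne :=
  closes hG (crossSpecialRung_of_spreadSpecialRung hS)

/-- The g19 node's `closes` is RECOVERED from the cross halves plus engine-free monotonicity (nothing of g19 is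
lost). [folklore] -/
theorem spread_closes_of_cross (hG : CrossGenericRung) (hS : CrossSpecialRung) : MaxContactCut.RungOne :=
  Spread.closes (spreadGenericRung_of_crossGenericRung hG) ((spreadSpecialRung_iff_crossSpecialRung hG).mpr hS)

end Kernels

end Cross

end Summit.ResolutionOfSingularities.ResolutionOfSingularities.Theorems.CrossCut
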